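import Summits.AtomisticToContinuum.HydrodynamicLimit.Theses.TwoClocks
import Summits.AtomisticToContinuum.HydrodynamicLimit.Theses.OneFlightGossipEngine
import Summits.AtomisticToContinuum.HydrodynamicLimit.Theorems.ImplosionDichotomyHydroLimitInBandSignedInputs
import Summits.AtomisticToContinuum.HydrodynamicLimit.Theorems.ImplosionDichotomyHydroLimitProfilewiseBandKcwfQReduction
import Summits.AtomisticToContinuum.HydrodynamicLimit.Theorems.ImplosionDichotomyHydroLimitInBandActivityTailsOfTransfer
import Summits.AtomisticToContinuum.HydrodynamicLimit.Theorems.TwoClocksTransferEntropyClockFamilyNodesReduction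
import Summits.AtomisticToContinuum.HydrodynamicLimit.Theorems.OneFlightGossipEngineLocalClampedTransferLDAlongFamiliesSAxisNet
import Summits.AtomisticToContinuum.HydrodynamicLimit.Theorems.TwoClocksTransferEntropyClockRateNodes
import Summits.AtomisticToContinuum.HydrodynamicLimit.Theorems.TwoClocksTransferEntropyClockThreeStubs
import HarnessLib

/-!
# Line `tail-rate` — crux stmt-AtomisticToContinuum-16625 `TwoClocks.TransferEntropyClock` — skeleton v16 (lead c6, 2026-08-17)

`TransferEntropyClock := KineticWindowLDUniform → ClampedTransferWindowLD → TransferActivityTails → EnergyCurrentTails →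
DiluteSelfConsistency → _root_.HydrodynamicLimit`.

HISTORY. v13 (lead c5) closed the crux modulo {KCWUSharpPlus, LocalClampedTransferWindowLDFamily, UGibbsSRBRigidity.GaussianTails} through the
landed tail-rate glue p145986. v14/v15 (lead c6) re-typed the last two onto the registered stubs of their owners — `LCTSharp` (crux 17691's one
open stub, via the landed s-axis net p147087) and 14415's three birth stubs, of which the t = 0 tails (p163416) and the tail-to-moment conversion
(p163538) were LANDED in wave 1, leaving 14415's propagation stub; the composition over the three stubs is landed (p164383
`TransferEntropyClockThreeStubs.transferEntropyClock_of_threeStubs`), and the kinetic child docks on the one kinetic wall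
`KineticWindowLDBoundsUniform` of 9282/14443/16659 (p164091).

v16 WEAKENS THE A-PRIORI CHILD TO THE WEAKEST SUFFICIENT STATEMENT. The only use of Gaussian tails in every clock of this sub-problem is a
super-exponential bound on the true-law CUBIC velocity tails (the cubic channel of the energy row, cut-off sent to infinity after the Grönwall at a
rate linear in the cut-off). That statement is the EXISTING item stmt-17701 `OneFlightGossipEngine.SuperExponentialEnergyTails` (SEET), strictly
weaker than 14415 (`TransferEntropyClockRateNodes.seet_of_gaussianTails`, p142914) and hence than 14415's propagation stub
(`seet_of_tailPropagation` below, through p164383), and independently staffed (17701's line: closed modulo its three true-law contact stubs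
PovznerCeiling / ChaosCeiling / RateFloor). Since the OneFlightGossipEngine repair rev 37, the heart's signed-band composition is LANDED with SEET
as its tail input: `HydroLimitInBandSignedBand.hydrodynamicLimit_of_signedInputs : SEET → KCWF-Q → LCTF(17691) → EAT → CAT → HydrodynamicLimit`
(p148646; DOCK-Q stmt-18054 closed by it), with `KCWF-Q ⇐ KCWUSharpPlus` landed (`HydroLimitProfilewiseBandKcwfQ.kcwfQ_of_kcwuSharpPlus`, 17372-c8)
and `EAT ∧ CAT ⇐ TwoClocks.TransferActivityTails` landed (`HydroLimitInBandHeart.activityTails_of_transferActivityTails`). So the crux is closed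
modulo the three sorries below with NO new plumbing:

* S_K `stub_kcwuSharpPlus : KCWUSharpPlus` — verbatim crux 16659's registered stub (⇐ the one wall `KineticWindowLDBoundsUniform`, p164091);
* S_L′ `stub_lctSharp : LocalClampedTransferSketch.LCTSharp` — verbatim crux 17691's registered stub;
* S_S `stub_seet : OneFlightGossipEngine.SuperExponentialEnergyTails` — item 17701 BY NAME (verbatim crux 17615's registered stub `stub_seet`);
  closable by 17701's own line OR by 14415's propagation stub (`seet_of_tailPropagation`, kernel-checked below) OR by 14415 itself (p142914).

Every static / plumbing obligation below the clock is landed; the open content of the crux is {one kinetic window-LD wall, one collisional window-LD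
wall, one true-law cubic-tail a-priori bound} — three research statements, each shared verbatim with the registered stub of a staffed sibling item.
TA is consumed (CAT, EAT); C′ is implied by LCT♯ (p147268); ECT is implied by SEET (`ClampedTransferDockSeet.seet_imp_energyCurrentTails`); KWLDU
and DSC are idle (DSC since the D-0032 re-type; KWLDU ⇐ KCWUSharpPlus's support consequence 14662-sharp).
Disproof.lean (tree, unchanged since 2026-08-16T22:05Z): no kill; §5/§6 shape constraints honoured (S_K `∃β₀` after bounds; S_L′ `∃V₀ ∀V ∃β₀` before
`τ₀`); no `-- Targets` entry. Refuted siblings never formed here: 17700 (band child), 14607 (e^{-cN} cubic budget; SEET is an expectation bound with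
`+ ε`, its one-Maxwellian-outlier witness does not bite — 17701's Disproof: NO KILL).
-/

noncomputable section

namespace Summit.AtomisticToContinuum.HydrodynamicLimit.Cruxes.TransferEntropyClock.TailRate

open MeasureTheory Filter Set Topology InformationTheory
open scoped ENNReal
open Literature.MathematicalPhysics.KineticTheory Literature.Analysis.FluidPDE Literature.Analysis.FunctionSpaces
open Summit.AtomisticToContinuum.HydrodynamicLimit.Theses
open Summit.AtomisticToContinuum.HydrodynamicLimit.Theorems
open Summit.AtomisticToContinuum.HydrodynamicLimit.Theorems.LocalClampedTransferSketch (LCTSharp)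

/-! ## §1 Statements -/

/-- **S_K target `KCWUSharpPlus`** — byte-identical with the registered open stub `stub_kcwuSharpPlus` of crux
stmt-AtomisticToContinuum-16659 (line `Sketch` v6) and with `Theorems.TransferEntropyClockTailRate.KCWUSharpPlus` (p143292):
the POINTWISE kinetic-window LD rung with a NUMERIC tilt threshold `β₀ = β₀(Θ,U,C,Λ,σ)` for the class
`A(x):w⊗w + (b(x)·w)G(x,|w|²) + K(x,|w|²)`, `w = v − u₀(x)`, growth `C(1+‖v‖²)`, orthogonal to `1, v_j, ‖v‖²` under the
local Maxwellian at every `x`. -/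
def KCWUSharpPlus : Prop :=
  ∃ η₀ : ℝ, 0 < η₀ ∧ ∀ (Θ U C Λ : ℝ), 1 ≤ Θ → 0 ≤ U → 0 ≤ C → 1 ≤ Λ → ∀ σ : ℝ, 0 < σ →
      ∃ β₀ : ℝ, 0 < β₀ ∧
      ∀ (a θ₀ : T3 → ℝ) (u₀ : T3 → V3), Continuous a → Continuous θ₀ → Continuous u₀ →
      (∀ x, Λ⁻¹ ≤ a x ∧ a x ≤ Λ) → (∀ x, Θ⁻¹ ≤ θ₀ x ∧ θ₀ x ≤ Θ) → (∀ x, ‖u₀ x‖ ≤ U) →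
      σ ^ 3 * (⨆ x, a x) ≤ η₀ * ∫ x, a x →
      ∀ Φ : (N : ℕ) →
        HardSphereFlow (Torus.geometry (Fin 3)) (hsDiameter σ N) (N + 1),
      ∀ (A : T3 → Fin 3 → Fin 3 → ℝ) (b : T3 → V3) (G K : T3 × ℝ → ℝ),
      Continuous A → Continuous b → Continuous G → Continuous K →
      ∀ F : T3 × V3 → ℝ, (∀ y, F y =
        (∑ j : Fin 3, ∑ k : Fin 3, A y.1 j k * ((y.2 - u₀ y.1) j * (y.2 - u₀ y.1) k)) +
          (∑ j : Fin 3, b y.1 j * (y.2 - u₀ y.1) j) * G (y.1, ‖y.2 - u₀ y.1‖ ^ 2) +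
          K (y.1, ‖y.2 - u₀ y.1‖ ^ 2)) →
      (∀ y, |F y| ≤ C * (1 + ‖y.2‖ ^ 2)) →
      (∀ x, ∫ v, F (x, v) * localMaxwellian 1 (θ₀ x) (u₀ x) v = 0) →
      (∀ x (j : Fin 3), ∫ v, F (x, v) * v j * localMaxwellian 1 (θ₀ x) (u₀ x) v = 0) →
      (∀ x, ∫ v, F (x, v) * ‖v‖ ^ 2 * localMaxwellian 1 (θ₀ x) (u₀ x) v = 0) →
      ∀ β : ℝ, |β| ≤ β₀ → ∀ ε : ℝ, 0 < ε → ∃ τ₀ : ℝ, 0 < τ₀ ∧ ∀ τ : ℝ, τ₀ ≤ τ →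
      ∃ N₀ : ℕ, ∀ N : ℕ, N₀ ≤ N →
        ∫⁻ z, ENNReal.ofReal (Real.exp (β * ∑ i : Fin (N + 1),
            (τ * ((N : ℝ) + 1) ^ (-(1 / 3 : ℝ)))⁻¹ *
              ∫ r in (0 : ℝ)..(τ * ((N : ℝ) + 1) ^ (-(1 / 3 : ℝ))), F (((Φ N).flow r z) i)))
          ∂(localGibbsLaw σ a u₀ θ₀ N (Φ N)) ≤
        ENNReal.ofReal (Real.exp (ε * ((N : ℝ) + 1)))

/-! ## §2 Stubs -/

/-- S_K (open, research-level; shared verbatim with crux 16659's `stub_kcwuSharpPlus`; implied by the one kinetic wall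
`KineticWindowGronwallPlusNode.KineticWindowLDBoundsUniform` of 9282/14443/16659, `TransferEntropyClockKineticWall.kcwuSharpPlus_of_boundsUniform` p164091). -/
theorem stub_kcwuSharpPlus : KCWUSharpPlus := by
  sorry

/-- S_L′ (open, research-level; shared verbatim with crux 17691's ONE open stub `stub_lctSharp`): the profile-wise transfer-clamped,
EOS-projected, centred collisional window LD with NUMERIC clamp/tilt thresholds `V₀(Θ,U,Λ,Lφ,σ)`, `β₀(Θ,U,Λ,Lφ,σ,V)` under the
local Gibbs REFERENCE law (`Theorems.LocalClampedTransferSketch.LCTSharp`). -/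
theorem stub_lctSharp : LCTSharp := by
  sorry

/-- S_S (open, research-level a-priori estimate; item stmt-17701 BY NAME, verbatim crux 17615's registered stub `stub_seet`): the true-law cubic
velocity tails decay faster than every exponential, N-uniformly, below the Euler horizon — `∀ c > 0 ∃ K₀ ∀ K ≥ K₀ ∀ ε ∃ N₀ ∀ N ≥ N₀ ∀ s ≤ t,
E_λ[(N+1)⁻¹ Σᵢ ‖vᵢ(s)‖³ 1{‖vᵢ(s)‖ > K}] ≤ e^{-cK} + ε`. -/
theorem stub_seet : OneFlightGossipEngine.SuperExponentialEnergyTails := by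
  sorry

/-! ## §3 Kernel-checked remarks and the composition -/

/-- **S_S is implied by 14415's propagation stub** (the v15 a-priori child): tail propagation ⇒ GaussianTails
(`TransferEntropyClockThreeStubs.gaussianTails_of_tailPropagation`, p164383, over the landed t = 0 tails p163416 and conversion p163538) ⇒ SEET
(`TransferEntropyClockRateNodes.seet_of_gaussianTails`, p142914). So v16's third sorry is weaker than v15's. [folklore] -/
theorem seet_of_tailPropagation
    (hP : ∀ (a₀ θ₀ : Literature.MathematicalPhysics.KineticTheory.T3 → ℝ)
      (u₀ : Literature.MathematicalPhysics.KineticTheory.T3 → Literature.MathematicalPhysics.KineticTheory.V3),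
      Continuous a₀ → Continuous θ₀ → Continuous u₀ → (∀ x, 0 < a₀ x) → (∀ x, 0 < θ₀ x) →
      ∀ κ₀ : ℝ, 0 < κ₀ → ∀ C₀ : ENNReal, C₀ < ⊤ →
      (∀ (σ : ℝ) (N : ℕ)
          (Φ : Literature.Analysis.FluidPDE.HardSphereFlow
            (Literature.Analysis.FluidPDE.Torus.geometry (Fin 3))
            (Literature.MathematicalPhysics.KineticTheory.hsDiameter σ N) (N + 1))
          (k : ℕ),
          (∑ i : Fin (N + 1),
              Literature.MathematicalPhysics.KineticTheory.localGibbsLaw σ a₀ u₀ θ₀ N Φ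
                {z | (k : ℝ) ≤ ‖(z i).2‖}) ≤
            ((N : ENNReal) + 1) * C₀ * ENNReal.ofReal (Real.exp (-(κ₀ * (k : ℝ) ^ 2)))) →
      ∃ σ₀ : ℝ, 0 < σ₀ ∧ ∀ σ : ℝ, 0 < σ → σ < σ₀ →
        ∀ (T : ℝ) (ρ θ : ℝ → Literature.MathematicalPhysics.KineticTheory.T3 → ℝ)
          (u : ℝ → Literature.MathematicalPhysics.KineticTheory.T3 → Literature.MathematicalPhysics.KineticTheory.V3),
          Literature.MathematicalPhysics.KineticTheory.IsHardSphereEulerSolution σ T ρ u θ →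
          ∀ Φ : (N : ℕ) → Literature.Analysis.FluidPDE.HardSphereFlow
              (Literature.Analysis.FluidPDE.Torus.geometry (Fin 3))
              (Literature.MathematicalPhysics.KineticTheory.hsDiameter σ N) (N + 1),
            Literature.MathematicalPhysics.KineticTheory.TendstoHydroFieldsAt
                (fun N => Literature.MathematicalPhysics.KineticTheory.localGibbsLaw σ a₀ u₀ θ₀ N (Φ N))
                Φ ρ u θ 0 →
            ∀ t ∈ Set.Ico 0 T, ∃ κ : ℝ, 0 < κ ∧ ∃ C : ENNReal, C < ⊤ ∧ ∃ N₀ : ℕ, ∀ N : ℕ, N₀ ≤ N →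
              ∀ s ∈ Set.Icc 0 t, ∀ k : ℕ,
                (∑ i : Fin (N + 1),
                    Literature.MathematicalPhysics.KineticTheory.localGibbsLaw σ a₀ u₀ θ₀ N (Φ N)
                      {z | (k : ℝ) ≤ ‖((Φ N).flow s z i).2‖}) ≤
                  ((N : ENNReal) + 1) * C * ENNReal.ofReal (Real.exp (-(κ * (k : ℝ) ^ 2)))) :
    OneFlightGossipEngine.SuperExponentialEnergyTails :=
  TransferEntropyClockRateNodes.seet_of_gaussianTails (TransferEntropyClockThreeStubs.gaussianTails_of_tailPropagation hP)

/-- **S_K feeds the signed kinetic family node KCWF-Q** (landed reduction of crux 17372's lead c8). [folklore] -/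
theorem kcwfQ_of_stub (hK : KCWUSharpPlus) : HydroLimitInBandSignedBand.KineticCurrentsLDAlongFamiliesQ :=
  HydroLimitProfilewiseBandKcwfQ.kcwfQ_of_kcwuSharpPlus hK

/-- **S_L′ feeds item 17691** through its landed s-axis net (p147087). [folklore] -/
theorem lct_of_stub (hS : LCTSharp) : OneFlightGossipEngine.LocalClampedTransferLDAlongFamilies :=
  LocalClampedTransferSketch.stub_sAxisNet hS

/-- **The crux by name.** The landed signed-band composition of the heart (`hydrodynamicLimit_of_signedInputs`, p148646) fed S_S, KCWF-Q from
S_K, item 17691 from S_L′, and EAT ∧ CAT from the crux's own antecedent `TransferActivityTails` (`activityTails_of_transferActivityTails`; the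
heart's energy-activity tails are the same term as OneFlightGossipEngine's EAT). KWLDU, C′, ECT, DSC idle (see the module docstring). [folklore] -/
theorem TransferEntropyClock_of : TwoClocks.TransferEntropyClock :=
  fun _hKW _h₃ h₇ _h₆ _hS =>
    have hT := HydroLimitInBandHeart.activityTails_of_transferActivityTails
      (TransferEntropyClockFamilyNodes.transferActivityTails_iff_dock.mp h₇)
    HydroLimitInBandSignedBand.hydrodynamicLimit_of_signedInputs stub_seet (kcwfQ_of_stub stub_kcwuSharpPlus)
      (lct_of_stub stub_lctSharp) (show OneFlightGossipEngine.EnergyActivityTails from hT.2) hT.1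

end Summit.AtomisticToContinuum.HydrodynamicLimit.Cruxes.TransferEntropyClock.TailRate

end
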